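import Literature.Analysis.FluidPDE.TorusNSBeiraoDaVeigaCriterion
import Literature.Analysis.FluidPDE.TorusGradientVorticityLp
import HarnessLib

/-!
# The vorticity criterion `ω ∈ L^r(0,T; L^s)`, `2/r + 3/s = 2`, `3/2 < s < ∞`, for classical
# Navier–Stokes solutions on `T³` (continuation form)

Analysis/FluidPDE proof file (theorems only; no definitions, no named facts).

Search for candidate a priori estimates; no regularity claim. Sequel of
`TorusNSBeiraoDaVeigaCriterion.lean` (Beirão da Veiga's gradient criterion
`∇u ∈ L^r(0,T;L^s)`, `2/r + 3/s = 2`, `3/2 < s < ∞`, proved there on `T³` in continuation form)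
and of `TorusGradientVorticityLp.lean` (the periodic Calderón–Zygmund bound
`‖∂ⱼuᵢ‖_{L^s(T³)} ≤ C_s ∑ₗ‖ωₗ‖_{L^s(T³)}`, `1 < s < ∞`, Majda–Bertozzi 2002 (11.9), proved there
from the tree's periodic Hessian bound). Composing the two gives the criterion in terms of the
vorticity `ω = curl u` alone — the form in which the gradient criterion is usually quoted for
vorticity moments (Majda–Bertozzi 2002, §11.1: "`‖∇v‖_{L^p} ≤ C_p‖ω‖_{L^p}` … all the `L^p`
norms of the gradient are controlled by the vorticity", `1 < p < ∞`):

* `torusVorticitySqAt_eq_sum_curl_sq` — on `T³`, `|ω|² := torusVorticitySqAt u = ∑ₗ (curl u)ₗ²`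
  with the tree's `BDSV.curl`.
* `Torus.exists_gradLs_le_vorticityLs` — for `1 < s` there is `K` (`= 27 C_s`) with
  `(∫ |∇v|^s)^{1/s} ≤ K (∫ |ω|^s)^{1/s}` for every smooth divergence-free `v` on `T³`,
  `|∇v| = (∑ⱼ‖∂ⱼv‖²)^{1/2}`, `|ω| = (torusVorticitySqAt v)^{1/2}` (Bochner-integral form of the
  `eLpNorm` statement `BDSV.exists_eLpNorm_partialDeriv_le_curl`).
* `Torus.classicalNS_continuation_of_vorticityLs_rpow_integral_le` — **the vorticity criterion on
  `T³`, continuation form**: along a classical solution of the unforced Navier–Stokes equations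
  (`ν > 0`, mean-zero slices) on `[0, T) × T³`, a continuous majorant `N(t) ≥ ‖ω(t)‖_{L^s}`,
  `3/2 < s < ∞`, with `∫₀ᵗ N^{2s/(2s−3)} ≤ I` on `[0, T)` gives continuation past `T`.

Scope (faithfulness): `T³ = UnitAddTorus (Fin 3)` only (the Calderón–Zygmund file is stated on
`Fin 3`); classical solutions with mean-zero slices, continuous majorant with bounded primitive
in place of `ω ∈ L^r(0,T;L^s)`; the endpoint `s = ∞` (`r = 1`) is the Beale–Kato–Majda
continuation criterion `Torus.classicalNS_bkm_continuation` (`TorusNSBealeKatoMajda`), `s = 3/2`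
is excluded as in print. Constants inexplicit (`C_s` of the tree is).
-- TODO(general form): `card d = 3` index types (transfer `UnitAddTorus d ≃ T³`).

## Mathlib / tree search

Tree (used): `BDSV.exists_eLpNorm_partialDeriv_le_curl`, `BDSV.curl_apply_zero/one/two`
(`TorusGradientVorticityLp`, `OnsagerBDSVBiotSavart`),
`Torus.classicalNS_continuation_of_gradLs_rpow_integral_le` (`TorusNSBeiraoDaVeigaCriterion`);
Mathlib `eLpNorm_sum_le`, `eLpNorm_mono_real`, `MemLp.eLpNorm_eq_integral_rpow_norm`.
Searched: `vorticityLs|curl.*L\^s.*continuation` — nothing.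

## References

* [BeiraoDaVeiga1995] H. Beirão da Veiga, *A new regularity class for the Navier–Stokes
  equations in ℝⁿ*, Chinese Ann. Math. Ser. B 16 (1995) 407–412 (the gradient criterion;
  restated Robinson–Rodrigo–Sadowski 2016, Notes to Ch. 8, p. 135).
* [MajdaBertozziCUP2002] A. J. Majda, A. L. Bertozzi, *Vorticity and Incompressible Flow*, CUP
  2002, §11.1 eq. (11.9) with Prop. 10.6 (`‖∇v‖_{L^p} ≤ C_p‖ω‖_{L^p}`, `1 < p < ∞`).
-/

noncomputable section

open Set MeasureTheory intervalIntegral Filter Real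
open scoped InnerProductSpace RealInnerProductSpace Topology ENNReal NNReal

namespace Literature.Analysis.FluidPDE

open Literature.Analysis.FunctionSpaces

/-! ### `|ω|² = ∑ₗ (curl u)ₗ²` on `T³` -/

/-- On `T³` the orientation-free squared vorticity `torusVorticitySqAt u (x) = ½∑ᵢⱼ(∂ᵢuⱼ − ∂ⱼuᵢ)²`
is `|curl u (x)|² = ∑ₗ (curl u (x))ₗ²` for the tree's `BDSV.curl` (the three vorticity
components are `∂₂u₃ − ∂₃u₂, ∂₃u₁ − ∂₁u₃, ∂₁u₂ − ∂₂u₁`).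
[cite: MajdaBertozziCUP2002, §1.4 eq. (1.31)] -/
theorem torusVorticitySqAt_eq_sum_curl_sq (v : UnitAddTorus (Fin 3) → EuclideanSpace ℝ (Fin 3))
    (x : UnitAddTorus (Fin 3)) :
    torusVorticitySqAt v x = ∑ l, BDSV.curl v x l ^ 2 := by
  simp only [torusVorticitySqAt, Fin.sum_univ_three, BDSV.curl_apply_zero, BDSV.curl_apply_one,
    BDSV.curl_apply_two]
  ring

/-- `√(∑ aᵢ²) ≤ ∑ aᵢ` for `aᵢ ≥ 0`. [folklore] -/
private theorem sqrt_sum_sq_le_sum {ι : Type*} [Fintype ι] (a : ι → ℝ) (ha : ∀ i, 0 ≤ a i) :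
    Real.sqrt (∑ i, a i ^ 2) ≤ ∑ i, a i := by
  have hS : 0 ≤ ∑ i, a i := Finset.sum_nonneg fun i _ => ha i
  refine Real.sqrt_le_iff.2 ⟨hS, ?_⟩
  calc ∑ i, a i ^ 2 = ∑ i, a i * a i := Finset.sum_congr rfl fun i _ => sq (a i)
    _ ≤ ∑ i, a i * ∑ k, a k := Finset.sum_le_sum fun i _ =>
        mul_le_mul_of_nonneg_left (Finset.single_le_sum (fun k _ => ha k) (Finset.mem_univ i))
          (ha i)
    _ = (∑ i, a i) ^ 2 := by rw [← Finset.sum_mul]; ring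

/-! ### `‖∇v‖_{L^s} ≤ K ‖ω‖_{L^s}` in Bochner-integral form -/

/-- **Calderón–Zygmund control of `|∇v|` by `|ω|` in `L^s(T³)`, `1 < s < ∞`, Bochner form**
(Majda–Bertozzi 2002, (11.9)): for `1 < s` there is `K ≥ 0` such that for every smooth
divergence-free `v` on `T³`, `(∫ |∇v|^s)^{1/s} ≤ K (∫ |ω|^s)^{1/s}` with
`|∇v| = (∑ⱼ‖∂ⱼv‖²)^{1/2}` and `|ω| = (torusVorticitySqAt v)^{1/2}` (from the componentwise
`eLpNorm` bound `BDSV.exists_eLpNorm_partialDeriv_le_curl`: `|∇v| ≤ ∑ⱼᵢ|∂ⱼvᵢ|`,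
`|(curl v)ₗ| ≤ |ω|`, Minkowski; `K = 27 C_s`).
[cite: MajdaBertozziCUP2002, §11.1 eq. (11.9) with Prop. 10.6] -/
theorem Torus.exists_gradLs_le_vorticityLs {s : ℝ} (hs : 1 < s) :
    ∃ K : ℝ, 0 ≤ K ∧ ∀ v : UnitAddTorus (Fin 3) → EuclideanSpace ℝ (Fin 3), Torus.IsSmooth v →
      Torus.IsDivFree v →
      (∫ x, Real.sqrt (∑ j, ‖Torus.partialDeriv j v x‖ ^ 2) ^ s) ^ (1 / s) ≤
        K * (∫ x, Real.sqrt (torusVorticitySqAt v x) ^ s) ^ (1 / s) := by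
  have hs0 : 0 < s := by linarith
  set q : ℝ≥0∞ := ENNReal.ofReal s with hq
  have hq1 : 1 < q := by rw [hq]; exact ENNReal.one_lt_ofReal.2 hs
  have hqtop : q < ⊤ := ENNReal.ofReal_lt_top
  have hq0 : q ≠ 0 := (zero_lt_one.trans hq1).ne'
  have hqr : q.toReal = s := ENNReal.toReal_ofReal hs0.le
  obtain ⟨C, hC⟩ := BDSV.exists_eLpNorm_partialDeriv_le_curl hq1 hqtop
  refine ⟨27 * C, by positivity, fun v hv hdiv => ?_⟩
  set f : UnitAddTorus (Fin 3) → ℝ :=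
    fun x => Real.sqrt (∑ j, ‖Torus.partialDeriv j v x‖ ^ 2) with hf
  set g : UnitAddTorus (Fin 3) → ℝ := fun x => Real.sqrt (torusVorticitySqAt v x) with hg
  have hDc : ∀ j, Continuous (Torus.partialDeriv j v) := fun j => (hv.partialDeriv j).continuous
  have hDic : ∀ j i, Continuous fun x => Torus.partialDeriv j v x i :=
    fun j i => (EuclideanSpace.proj i).continuous.comp (hDc j)
  have hfc : Continuous f :=
    Real.continuous_sqrt.comp (continuous_finsetSum _ fun j _ => ((hDc j).norm).pow 2)
  have hωc : Continuous fun x => torusVorticitySqAt v x := by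
    simp only [torusVorticitySqAt_eq_sum_curl_sq]
    refine continuous_finsetSum _ fun l _ => Continuous.pow ?_ 2
    fin_cases l
    · exact (hDic 1 2).sub (hDic 2 1)
    · exact (hDic 2 0).sub (hDic 0 2)
    · exact (hDic 0 1).sub (hDic 1 0)
  have hgc : Continuous g := Real.continuous_sqrt.comp hωc
  have hf0 : ∀ x, 0 ≤ f x := fun x => Real.sqrt_nonneg _
  have hg0 : ∀ x, 0 ≤ g x := fun x => Real.sqrt_nonneg _
  -- pointwise: `f ≤ ∑ⱼᵢ |∂ⱼvᵢ|`, `|(curl v)ₗ| ≤ g`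
  set F : Fin 3 × Fin 3 → UnitAddTorus (Fin 3) → ℝ :=
    fun ji x => |Torus.partialDeriv ji.1 v x ji.2| with hF
  have hf_le : ∀ x, f x ≤ ∑ ji, F ji x := by
    intro x
    have h1 : f x ≤ ∑ j, ‖Torus.partialDeriv j v x‖ :=
      sqrt_sum_sq_le_sum (fun j => ‖Torus.partialDeriv j v x‖) fun j => norm_nonneg _
    have h2 : ∀ j, ‖Torus.partialDeriv j v x‖ ≤ ∑ i, |Torus.partialDeriv j v x i| := by
      intro j
      rw [EuclideanSpace.norm_eq]
      have e : ∀ i, ‖Torus.partialDeriv j v x i‖ ^ 2 = |Torus.partialDeriv j v x i| ^ 2 :=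
        fun i => by rw [Real.norm_eq_abs]
      simp only [e]
      exact sqrt_sum_sq_le_sum _ fun i => abs_nonneg _
    calc f x ≤ ∑ j, ‖Torus.partialDeriv j v x‖ := h1
      _ ≤ ∑ j, ∑ i, |Torus.partialDeriv j v x i| := Finset.sum_le_sum fun j _ => h2 j
      _ = ∑ ji, F ji x := by rw [hF, ← Fintype.sum_prod_type']
  have hcurl_le : ∀ x l, |BDSV.curl v x l| ≤ g x := by
    intro x l
    refine Real.abs_le_sqrt ?_
    rw [torusVorticitySqAt_eq_sum_curl_sq]
    exact Finset.single_le_sum (f := fun l => BDSV.curl v x l ^ 2) (fun _ _ => sq_nonneg _)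
      (Finset.mem_univ l)
  -- Minkowski: `‖f‖_q ≤ ∑ⱼᵢ ‖∂ⱼvᵢ‖_q`
  have hFm : ∀ ji, AEStronglyMeasurable (F ji) volume :=
    fun ji => ((hDic ji.1 ji.2).abs).aestronglyMeasurable
  have hstep1 : eLpNorm f q volume ≤ ∑ ji, eLpNorm (F ji) q volume := by
    have h1 : eLpNorm f q volume ≤ eLpNorm (fun x => ∑ ji, F ji x) q volume :=
      eLpNorm_mono_real fun x => by
        rw [Real.norm_eq_abs, abs_of_nonneg (hf0 x)]
        exact hf_le x
    have e : (fun x => ∑ ji, F ji x) = ∑ ji, F ji := by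
      funext x
      simp only [Finset.sum_apply]
    rw [e] at h1
    exact h1.trans (eLpNorm_sum_le (fun ji _ => hFm ji) hq1.le)
  -- Calderón–Zygmund for each entry, and `‖(curl v)ₗ‖_q ≤ ‖g‖_q`
  have hstep2 : ∀ ji, eLpNorm (F ji) q volume ≤ C * (3 * eLpNorm g q volume) := by
    intro ji
    have h1 : eLpNorm (F ji) q volume ≤
        eLpNorm (fun x => Torus.partialDeriv ji.1 v x ji.2) q volume :=
      eLpNorm_mono fun x => by simp [hF]
    have h2 := hC v hv hdiv ji.2 ji.1
    have h3 : ∑ l : Fin 3, eLpNorm (fun x => BDSV.curl v x l) q volume ≤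
        3 * eLpNorm g q volume := by
      have h4 : ∀ l, eLpNorm (fun x => BDSV.curl v x l) q volume ≤ eLpNorm g q volume :=
        fun l => eLpNorm_mono_real fun x => by rw [Real.norm_eq_abs]; exact hcurl_le x l
      calc ∑ l : Fin 3, eLpNorm (fun x => BDSV.curl v x l) q volume
          ≤ ∑ _l : Fin 3, eLpNorm g q volume := Finset.sum_le_sum fun l _ => h4 l
        _ = 3 * eLpNorm g q volume := by
            rw [Finset.sum_const, Finset.card_univ, Fintype.card_fin, nsmul_eq_mul]; norm_num
    calc eLpNorm (F ji) q volume
        ≤ eLpNorm (fun x => Torus.partialDeriv ji.1 v x ji.2) q volume := h1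
      _ ≤ C * ∑ l : Fin 3, eLpNorm (fun x => BDSV.curl v x l) q volume := h2
      _ ≤ C * (3 * eLpNorm g q volume) := by gcongr
  have hmain : eLpNorm f q volume ≤ ((27 * C : ℝ≥0) : ℝ≥0∞) * eLpNorm g q volume := by
    calc eLpNorm f q volume ≤ ∑ ji : Fin 3 × Fin 3, eLpNorm (F ji) q volume := hstep1
      _ ≤ ∑ _ji : Fin 3 × Fin 3, (C : ℝ≥0∞) * (3 * eLpNorm g q volume) :=
          Finset.sum_le_sum fun ji _ => hstep2 ji
      _ = ((27 * C : ℝ≥0) : ℝ≥0∞) * eLpNorm g q volume := by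
          rw [Finset.sum_const, Finset.card_univ, Fintype.card_prod, Fintype.card_fin, nsmul_eq_mul]
          push_cast
          ring
  -- Bochner form
  have conv : ∀ {φ : UnitAddTorus (Fin 3) → ℝ}, Continuous φ → (∀ x, 0 ≤ φ x) →
      eLpNorm φ q volume = ENNReal.ofReal ((∫ x, φ x ^ s) ^ (1 / s)) := by
    intro φ hφ hφ0
    rw [MemLp.eLpNorm_eq_integral_rpow_norm hq0 hqtop.ne
      (hφ.memLp_of_hasCompactSupport (HasCompactSupport.of_compactSpace φ)), hqr, one_div]
    congr 2
    exact integral_congr_ae (ae_of_all _ fun x => by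
      simp only [Real.norm_eq_abs, abs_of_nonneg (hφ0 x)])
  rw [conv hfc hf0, conv hgc hg0] at hmain
  have hB0 : 0 ≤ (∫ x, g x ^ s) ^ (1 / s) :=
    Real.rpow_nonneg (integral_nonneg fun x => Real.rpow_nonneg (hg0 x) _) _
  have e : ((27 * C : ℝ≥0) : ℝ≥0∞) * ENNReal.ofReal ((∫ x, g x ^ s) ^ (1 / s)) =
      ENNReal.ofReal (27 * C * (∫ x, g x ^ s) ^ (1 / s)) := by
    rw [ENNReal.ofReal_mul (by positivity), ← ENNReal.ofReal_coe_nnreal]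
    push_cast
    rfl
  rw [e] at hmain
  exact (ENNReal.ofReal_le_ofReal_iff (by positivity)).1 hmain

/-! ### The vorticity criterion on `T³`, continuation form -/

/-- **The vorticity criterion `ω ∈ L^r(0,T;L^s)`, `2/r + 3/s = 2`, `3/2 < s < ∞`, on `T³`
(continuation form)** — Beirão da Veiga's gradient criterion (1995; Robinson–Rodrigo–Sadowski
2016, Notes to Ch. 8, p. 135) composed with the Calderón–Zygmund bound
`‖∇u‖_{L^s} ≤ C_s‖ω‖_{L^s}` (Majda–Bertozzi 2002, (11.9)). Let `(u, p)` be a classical solution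
of the unforced Navier–Stokes equations with `ν > 0` on `[0, T) × T³`, `T > 0`, with mean-zero
velocity slices; let `3/2 < s` and let `N` be a continuous nonnegative majorant of
`‖ω(t)‖_{L^s}` on `[0, T)`, `(∫ (torusVorticitySqAt (u t))^{s/2})^{1/s} ≤ N(t)`, with
`∫₀ᵗ N^{2s/(2s−3)} ≤ I` for all `t ∈ [0, T)` (`r = 2s/(2s−3)`, `2/r + 3/s = 2`). Then the
solution continues to a classical solution with mean-zero slices on some `[0, T'] × T³`, `T' > T`,
equal to `u` on `[0, T)`.
[cite: BeiraoDaVeiga1995, Thm (restated RobinsonRodrigoSadowskiCUP2016 Notes to Ch. 8, p. 135)]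
[cite: MajdaBertozziCUP2002, §11.1 eq. (11.9)] -/
theorem Torus.classicalNS_continuation_of_vorticityLs_rpow_integral_le
    {ν T s : ℝ} (hν : 0 < ν) (hT : 0 < T) (hs : 3 / 2 < s)
    {u : ℝ → UnitAddTorus (Fin 3) → EuclideanSpace ℝ (Fin 3)} {p : ℝ → UnitAddTorus (Fin 3) → ℝ}
    (h : Torus.IsClassicalNSSolutionOn (Ico 0 T) ν 0 u p)
    (hmean : ∀ t ∈ Ico 0 T, Torus.HasZeroMean (u t)) {N : ℝ → ℝ}
    (hNc : ContinuousOn N (Ico 0 T)) (hN0 : ∀ t ∈ Ico 0 T, 0 ≤ N t)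
    (hN : ∀ t ∈ Ico 0 T, (∫ x, Real.sqrt (torusVorticitySqAt (u t) x) ^ s) ^ (1 / s) ≤ N t)
    {I : ℝ} (hI : ∀ t ∈ Ico 0 T, ∫ τ in (0 : ℝ)..t, N τ ^ (2 * s / (2 * s - 3)) ≤ I) :
    ∃ T' : ℝ, T < T' ∧ ∃ (u' : ℝ → UnitAddTorus (Fin 3) → EuclideanSpace ℝ (Fin 3))
      (p' : ℝ → UnitAddTorus (Fin 3) → ℝ),
      Torus.IsClassicalNSSolutionOn (Icc 0 T') ν 0 u' p' ∧
        (∀ t ∈ Icc 0 T', Torus.HasZeroMean (u' t)) ∧ ∀ t ∈ Ico 0 T, u' t = u t := by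
  have hd : Fintype.card (Fin 3) = 3 := Fintype.card_fin 3
  obtain ⟨K, hK0, hK⟩ := Torus.exists_gradLs_le_vorticityLs (by linarith : (1 : ℝ) < s)
  have h2s3 : 0 < 2 * s - 3 := by linarith
  set r : ℝ := 2 * s / (2 * s - 3) with hr
  have hr0 : 0 ≤ r := by rw [hr]; positivity
  refine Torus.classicalNS_continuation_of_gradLs_rpow_integral_le hd hν hT hs h hmean
    (N := fun t => K * N t) (continuousOn_const.mul hNc) (fun t ht => mul_nonneg hK0 (hN0 t ht))
    (fun t ht => ?_) (I := K ^ r * I) (fun t ht => ?_)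
  · have hut : Torus.IsSmooth (u t) := h.smooth_velocity.isSmooth_slice ht
    exact (hK (u t) hut (h.divFree t ht)).trans (mul_le_mul_of_nonneg_left (hN t ht) hK0)
  · have ht0 : 0 ≤ t := ht.1
    have e : ∫ τ in (0 : ℝ)..t, (K * N τ) ^ r = ∫ τ in (0 : ℝ)..t, K ^ r * N τ ^ r := by
      refine intervalIntegral.integral_congr fun τ hτ => ?_
      rw [uIcc_of_le ht0] at hτ
      have hτ' : τ ∈ Ico 0 T := ⟨hτ.1, hτ.2.trans_lt ht.2⟩
      exact Real.mul_rpow hK0 (hN0 τ hτ')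
    rw [e, intervalIntegral.integral_const_mul]
    exact mul_le_mul_of_nonneg_left (hI t ht) (Real.rpow_nonneg hK0 _)

end Literature.Analysis.FluidPDE

end
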